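import Summits.CriticalPhenomena.CardyFormulaZ2.Theorems.CardyFlipRussoVoronoiHubFromSmirnovDefs
import Literature.Analysis.FunctionSpaces.PoissonMeckeProofs
import Literature.Analysis.FunctionSpaces.PoissonSuperpositionProofs

/-!
# Stub `stub_meckeRusso` (S1) of line `moebius-exact-delaunay-dilation-ward` — preliminaries
# (crux `VoronoiHubFromSmirnov`, stmt-CriticalPhenomena-6433)

Shared groundwork for the Mecke–Russo identity (S1) and the Ward kernel (S2) of the line, over
the vocabulary of `CardyFlipRussoVoronoiHubFromSmirnovDefs`:

* `poissonLaw_spec`: the chooser `poissonLaw μ` IS a Poisson law as soon as one exists; for an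
  absolutely continuous intensity with continuous density on `ℂ` one exists (Kingman's existence
  theorem `existsUnique_isPoissonPointProcess_holds`: locally finite, atomless), in particular for
  every `intensity ρ t δ` with `ρ` continuous (`isPoissonPointProcess_poissonLaw_intensity`), so
  `lawBW (intensity ρ t δ)` is a probability measure.
* one-nucleus insertion `insertAt` is jointly measurable (`measurable_insertAt`, from the tree's
  `PointConfig.measurable_union_ofFn_one`), hence the insertion probabilities
  `z ↦ M.real {c | (insertAt z c.1, c.2) ∈ S}` are measurable for every s-finite law `M` on pairs
  of configurations (`measurable_measureReal_insertFst/Snd`, Mathlib's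
  `measurable_measure_prodMk_left`), the insertion response `insResp ρ t R δ` is measurable and
  bounded by `2`, and `z ↦ w (δ z) · insResp ρ t R δ z` is integrable for every continuous
  compactly supported weight `w` (`integrable_weight_mul_insResp`).

No new definitions. (Last–Penrose 2017, Ch. 3–4 for the Poisson process background.)
-/

noncomputable section

namespace Summit.CriticalPhenomena.CardyFormulaZ2.Cruxes.VoronoiHubFromSmirnov.MoebiusExactDelaunayDilationWard

open scoped Topology ENNReal Interval
open Filter Set MeasureTheory
open Literature.Analysis.FunctionSpaces
open Literature.Probability.RandomPlanarGeometry

/-! ### The Poisson law chooser -/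

/-- `poissonLaw μ` is a Poisson law with intensity `μ` whenever one exists (`Classical.epsilon_spec`).
[folklore] -/
theorem poissonLaw_spec : ∀ μ : Measure ℂ, (∃ P, IsPoissonPointProcess μ P) → IsPoissonPointProcess μ (poissonLaw μ) :=
  fun _ h => Classical.epsilon_spec h

/-- An intensity `φ(z) dz` with continuous density `φ ≥ 0` (negative parts truncated by
`ENNReal.ofReal`) is locally finite and atomless, so by Kingman's existence theorem
(`existsUnique_isPoissonPointProcess_holds`) `poissonLaw` of it is a Poisson law. [folklore] -/
theorem isPoissonPointProcess_poissonLaw_withDensity : ∀ φ : ℂ → ℝ, Continuous φ → IsPoissonPointProcess (volume.withDensity fun z => ENNReal.ofReal (φ z)) (poissonLaw (volume.withDensity fun z => ENNReal.ofReal (φ z))) := by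
  intro φ hφ
  haveI := IsLocallyFiniteMeasure.withDensity_ofReal (μ := (volume : Measure ℂ)) hφ
  refine poissonLaw_spec _
    (existsUnique_isPoissonPointProcess_holds (E := ℂ) _ fun x => ?_).exists
  exact withDensity_absolutelyContinuous _ _ (measure_singleton x)

/-- The density `z ↦ ρ_t(δ z) = 1 + t (ρ(δ z) - 1)` of `intensity ρ t δ` is continuous for
continuous `ρ`. [folklore] -/
theorem continuous_densityPath_mul : ∀ ρ : ℂ → ℝ, Continuous ρ → ∀ t δ : ℝ,
    Continuous fun z : ℂ => densityPath ρ t ((δ : ℂ) * z) := by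
  intro ρ hρ t δ
  unfold densityPath
  exact continuous_const.add (continuous_const.mul
    ((hρ.comp (continuous_const.mul continuous_id)).sub continuous_const))

/-- For a continuous profile `ρ`, every `intensity ρ t δ` is the intensity of a Poisson law, and
`poissonLaw (intensity ρ t δ)` is one. [folklore] -/
theorem isPoissonPointProcess_poissonLaw_intensity : ∀ ρ : ℂ → ℝ, Continuous ρ → ∀ t δ : ℝ, IsPoissonPointProcess (intensity ρ t δ) (poissonLaw (intensity ρ t δ)) :=
  fun ρ hρ t δ => isPoissonPointProcess_poissonLaw_withDensity _ (continuous_densityPath_mul ρ hρ t δ)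

/-- An admissible profile is continuous. [folklore] -/
theorem AdmissibleDensity.continuous {ρ : ℂ → ℝ} (hρ : AdmissibleDensity ρ) : Continuous ρ :=
  hρ.1.continuous

/-- `poissonLaw (intensity ρ t δ)` is a probability measure (continuous `ρ`). [folklore] -/
theorem isProbabilityMeasure_poissonLaw_intensity : ∀ ρ : ℂ → ℝ, Continuous ρ → ∀ t δ : ℝ,
    IsProbabilityMeasure (poissonLaw (intensity ρ t δ)) :=
  fun ρ hρ t δ => (isPoissonPointProcess_poissonLaw_intensity ρ hρ t δ).isProbabilityMeasure

/-- `lawBW (intensity ρ t δ)` (two independent copies) is a probability measure (continuous `ρ`).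
[folklore] -/
theorem isProbabilityMeasure_lawBW_intensity : ∀ ρ : ℂ → ℝ, Continuous ρ → ∀ t δ : ℝ, IsProbabilityMeasure (lawBW (intensity ρ t δ)) := by
  intro ρ hρ t δ
  haveI := isProbabilityMeasure_poissonLaw_intensity ρ hρ t δ
  unfold lawBW
  infer_instance

/-! ### Insertion of one nucleus -/

/-- `insertAt z c = c ∪ {z}` in the spelling `PointConfig.ofFn (fun _ : Fin 1 => z)` of the tree's
Mecke files. [folklore] -/
theorem insertAt_eq : ∀ (z : ℂ) (c : PointConfig ℂ),
    insertAt z c = c ∪ PointConfig.ofFn (fun _ : Fin 1 => z) := by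
  intro z c
  have : (![z] : Fin 1 → ℂ) = fun _ => z := by
    funext i
    fin_cases i
    rfl
  rw [insertAt, this]

/-- Membership in `insertAt z c`. [folklore] -/
@[simp] theorem mem_insertAt {z y : ℂ} {c : PointConfig ℂ} : y ∈ insertAt z c ↔ y ∈ c ∨ y = z := by
  simp [insertAt_eq, PointConfig.mem_union, PointConfig.mem_ofFn, eq_comm]

/-- `c ∪ ∅ = c` for configurations. [folklore] -/
@[simp] theorem union_empty (c : PointConfig ℂ) : c ∪ (∅ : PointConfig ℂ) = c := by
  ext y
  simp only [PointConfig.mem_union, or_iff_left_iff_imp]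
  exact fun h => False.elim h

/-- Inserting into `c` is superposing `c` with the one-point configuration `insertAt z ∅`.
[folklore] -/
@[simp] theorem union_insertAt_empty (z : ℂ) (c : PointConfig ℂ) :
    c ∪ insertAt z ∅ = insertAt z c := by
  ext y
  simp only [PointConfig.mem_union, mem_insertAt]
  constructor
  · rintro (h | h | h)
    · exact Or.inl h
    · exact False.elim h
    · exact Or.inr h
  · rintro (h | h)
    · exact Or.inl h
    · exact Or.inr (Or.inr h)

/-- A configuration with no point is the empty configuration. [folklore] -/
theorem eq_empty_of_count_univ {c : PointConfig ℂ} (h : c.count univ = 0) : c = ∅ := by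
  apply SetLike.ext'
  simpa [PointConfig.count] using h

/-- **Insertion is jointly measurable**: `(z, c) ↦ c ∪ {z}` (the tree's
`PointConfig.measurable_union_ofFn_one`). [folklore] -/
theorem measurable_insertAt : Measurable fun p : ℂ × PointConfig ℂ => insertAt p.1 p.2 := by
  simp_rw [insertAt_eq]
  exact PointConfig.measurable_union_ofFn_one

/-- Insertion of a fixed nucleus is measurable in the configuration. [folklore] -/
theorem measurable_insertAt_right (z : ℂ) : Measurable (insertAt z) :=
  measurable_insertAt.comp (measurable_const.prodMk measurable_id)

/-- Insertion into a fixed configuration is measurable in the nucleus. [folklore] -/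
theorem measurable_insertAt_left (c : PointConfig ℂ) : Measurable fun z : ℂ => insertAt z c :=
  measurable_insertAt.comp (measurable_id.prodMk measurable_const)

/-! ### Measurability of insertion events and insertion probabilities -/

/-- The black-insertion event `{c | (c.1 ∪ {z}, c.2) ∈ S}` is measurable. [folklore] -/
theorem measurableSet_insertFst {S : Set (PointConfig ℂ × PointConfig ℂ)} (hS : MeasurableSet S)
    (z : ℂ) : MeasurableSet {c : PointConfig ℂ × PointConfig ℂ | (insertAt z c.1, c.2) ∈ S} :=
  hS.preimage (((measurable_insertAt_right z).comp measurable_fst).prodMk measurable_snd)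

/-- The white-insertion event `{c | (c.1, c.2 ∪ {z}) ∈ S}` is measurable. [folklore] -/
theorem measurableSet_insertSnd {S : Set (PointConfig ℂ × PointConfig ℂ)} (hS : MeasurableSet S)
    (z : ℂ) : MeasurableSet {c : PointConfig ℂ × PointConfig ℂ | (c.1, insertAt z c.2) ∈ S} :=
  hS.preimage (measurable_fst.prodMk ((measurable_insertAt_right z).comp measurable_snd))

/-- The black-insertion probability `z ↦ M{c | (c.1 ∪ {z}, c.2) ∈ S}` is measurable for every
s-finite law `M` on pairs of configurations (a section measure of a measurable subset of
`ℂ × (PointConfig ℂ × PointConfig ℂ)`). [folklore] -/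
theorem measurable_measureReal_insertFst (M : Measure (PointConfig ℂ × PointConfig ℂ)) [SFinite M]
    {S : Set (PointConfig ℂ × PointConfig ℂ)} (hS : MeasurableSet S) :
    Measurable fun z : ℂ => M.real {c | (insertAt z c.1, c.2) ∈ S} := by
  have hT : MeasurableSet {q : ℂ × (PointConfig ℂ × PointConfig ℂ) | (insertAt q.1 q.2.1, q.2.2) ∈ S} :=
    hS.preimage ((measurable_insertAt.comp (measurable_fst.prodMk (measurable_fst.comp measurable_snd))).prodMk
      (measurable_snd.comp measurable_snd))
  exact ENNReal.measurable_toReal.comp (measurable_measure_prodMk_left hT)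

/-- The white-insertion probability `z ↦ M{c | (c.1, c.2 ∪ {z}) ∈ S}` is measurable for every
s-finite law `M` on pairs of configurations. [folklore] -/
theorem measurable_measureReal_insertSnd (M : Measure (PointConfig ℂ × PointConfig ℂ)) [SFinite M]
    {S : Set (PointConfig ℂ × PointConfig ℂ)} (hS : MeasurableSet S) :
    Measurable fun z : ℂ => M.real {c | (c.1, insertAt z c.2) ∈ S} := by
  have hT : MeasurableSet {q : ℂ × (PointConfig ℂ × PointConfig ℂ) | (q.2.1, insertAt q.1 q.2.2) ∈ S} :=
    hS.preimage ((measurable_fst.comp measurable_snd).prodMk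
      (measurable_insertAt.comp (measurable_fst.prodMk (measurable_snd.comp measurable_snd))))
  exact ENNReal.measurable_toReal.comp (measurable_measure_prodMk_left hT)

/-- The generic insertion response `z ↦ M{ins₁ ∈ S} + M{ins₂ ∈ S} - 2 M(S)` of a law `M` on
pairs is measurable. [folklore] -/
theorem measurable_insResp_gen (M : Measure (PointConfig ℂ × PointConfig ℂ)) [SFinite M]
    {S : Set (PointConfig ℂ × PointConfig ℂ)} (hS : MeasurableSet S) :
    Measurable fun z : ℂ => M.real {c | (insertAt z c.1, c.2) ∈ S}
      + M.real {c | (c.1, insertAt z c.2) ∈ S} - 2 * M.real S :=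
  ((measurable_measureReal_insertFst M hS).add (measurable_measureReal_insertSnd M hS)).sub
    measurable_const

/-- The generic insertion response of a probability law on pairs is bounded by `2`. [folklore] -/
theorem abs_insResp_gen_le_two (M : Measure (PointConfig ℂ × PointConfig ℂ)) [IsProbabilityMeasure M]
    (S : Set (PointConfig ℂ × PointConfig ℂ)) (z : ℂ) :
    |M.real {c | (insertAt z c.1, c.2) ∈ S} + M.real {c | (c.1, insertAt z c.2) ∈ S}
      - 2 * M.real S| ≤ 2 := by
  have h1 := measureReal_le_one (μ := M) (s := {c | (insertAt z c.1, c.2) ∈ S})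
  have h2 := measureReal_le_one (μ := M) (s := {c | (c.1, insertAt z c.2) ∈ S})
  have h3 := measureReal_le_one (μ := M) (s := S)
  have h1' := measureReal_nonneg (μ := M) (s := {c | (insertAt z c.1, c.2) ∈ S})
  have h2' := measureReal_nonneg (μ := M) (s := {c | (c.1, insertAt z c.2) ∈ S})
  have h3' := measureReal_nonneg (μ := M) (s := S)
  rw [abs_le]
  constructor <;> linarith

/-! ### The insertion response of the line -/

/-- `insResp ρ t R δ` is measurable in the insertion point, given measurability of the crossing
event (continuous `ρ`). [folklore] -/
theorem measurable_insResp : ∀ ρ : ℂ → ℝ, Continuous ρ → ∀ (t : ℝ) (R : ConformalRectangle) (δ : ℝ), MeasurableSet (crossEvent R δ) → Measurable (insResp ρ t R δ) := by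
  intro ρ hρ t R δ hE
  haveI := isProbabilityMeasure_lawBW_intensity ρ hρ t δ
  exact measurable_insResp_gen (lawBW (intensity ρ t δ)) hE

/-- `|insResp ρ t R δ z| ≤ 2` (continuous `ρ`). [folklore] -/
theorem abs_insResp_le_two : ∀ ρ : ℂ → ℝ, Continuous ρ → ∀ (t : ℝ) (R : ConformalRectangle) (δ : ℝ) (z : ℂ), |insResp ρ t R δ z| ≤ 2 := by
  intro ρ hρ t R δ z
  haveI := isProbabilityMeasure_lawBW_intensity ρ hρ t δ
  exact abs_insResp_gen_le_two (lawBW (intensity ρ t δ)) (crossEvent R δ) z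

/-! ### Integrability against compactly supported weights -/

/-- A continuous compactly supported function times a bounded measurable function is integrable
(Lebesgue measure on `ℂ`). [folklore] -/
theorem integrable_mul_of_continuous_of_bounded {φ G : ℂ → ℝ} (hφ : Continuous φ)
    (hφs : HasCompactSupport φ) (hG : Measurable G) {C : ℝ} (hGC : ∀ z, |G z| ≤ C) :
    Integrable fun z => φ z * G z := by
  have hint : Integrable φ := hφ.integrable_of_hasCompactSupport hφs
  have := hint.mul_bdd (c := C) hG.aestronglyMeasurable (Eventually.of_forall fun z => by
    rw [Real.norm_eq_abs]; exact hGC z)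
  exact this

/-- Rescaling a compactly supported weight by a nonzero mesh keeps compact support. [folklore] -/
theorem hasCompactSupport_comp_mul {w : ℂ → ℝ} (hw : HasCompactSupport w) {δ : ℝ} (hδ : δ ≠ 0) :
    HasCompactSupport fun z : ℂ => w ((δ : ℂ) * z) :=
  hw.comp_homeomorph (Homeomorph.mulLeft₀ (δ : ℂ) (Complex.ofReal_ne_zero.2 hδ))

/-- **Integrability of the weighted insertion response** (the integrability conjunct of S1 and S2,
for general weights): for an admissible profile `ρ`, a continuous compactly supported weight `w`,
mesh `δ > 0`, a measurable crossing event and `t ∈ [0,1]`, `z ↦ w(δ z) · insResp ρ t R δ z` is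
Lebesgue integrable (bounded measurable times continuous compactly supported). [folklore] -/
theorem integrable_weight_mul_insResp : ∀ ρ, AdmissibleDensity ρ → ∀ (w : ℂ → ℝ), Continuous w → HasCompactSupport w → ∀ (R : ConformalRectangle) (δ : ℝ), 0 < δ → MeasurableSet (crossEvent R δ) → ∀ t ∈ Icc (0:ℝ) 1, Integrable fun z => w ((δ : ℂ) * z) * insResp ρ t R δ z := by
  intro ρ hρ w hw hws R δ hδ hE t _
  exact integrable_mul_of_continuous_of_bounded (hw.comp (continuous_const.mul continuous_id))
    (hasCompactSupport_comp_mul hws hδ.ne') (measurable_insResp ρ hρ.continuous t R δ hE)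
    (abs_insResp_le_two ρ hρ.continuous t R δ)

end Summit.CriticalPhenomena.CardyFormulaZ2.Cruxes.VoronoiHubFromSmirnov.MoebiusExactDelaunayDilationWard

end
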